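/-
Copyright: the b2b-balaban T⁴-continuum CRUX team, row NE7b leaf lineage `t4-ne7b-formalise-leaf-06` (gen 156). Project licence.
-/
import Summits.QuantumFields.BalabanUV.T4Continuum.Spine.NE7b.HardStepInductiveStepCritical
import Summits.QuantumFields.BalabanUV.T4Continuum.Spine.NE7b.ActionScalingLetters

/-!
# THE INDUCTIVE STEP IN COERCIVITY UNITS WITH THE BRANCH's CONSTRAINED CRITICALITY EXPORTED: `inductiveStep_critical` applied to
# the action measured in units of its own kernel coercivity,
# `m⁻¹ • V` — every letter dimensionless, the equivalence letter `(1 + ‖V″δ₀‖∕m)‖M‖ + 1 ≤ N`, the Neumann margin `c < N⁻¹` for the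
# RELATIVE modulus `‖V″x − V″δ₀‖ ≤ c·m`, the chart constant `K₁ = (N⁻¹ − c)⁻¹`, PLUS conjunct (o) `DV(σw)|_{ker D} = 0` on the chart —
# the hypothesis of `…TransportedHessianEnergyCeiling` (row NE7b, node U5c; assembly of this lineage's `HardStepInductiveStepCritical`
# (HSIC) and `ActionScalingLetters` (ASL) BY NAME — the critical twin of `…HardStepUnitStep`; [folklore])

Cell `pub-balaban`, sub-cell `t4`, spine estimate NE7b (`T4WeightBudget.RelWeightBound`; the cell's OWN estimate — NOT PRINTED in
[Bałaban 1983–89], NOT PROVED).  Crux-route work under `Spine/NE7b/` by a row leaf (`t4-ne7b-formalise-leaf-06` gen 156) in the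
hard-step cell under FREEZE (0)'s crux-prover clause; NOTHING of Bałaban's is named as a Lean object, valued or asserted; no
`T4Continuum/Support` leaf typed; no `def`; zero `sorry`.  Imports: HSIC (`inductiveStep_critical`; through it AHE, HSCR, HSBD, HSBDM,
HSAH, HSTL) and ASL (`unit_letters`, `unit_equivBound`) — both this lineage's.  The non-critical twin `…HardStepUnitStep` (HSUS) is the
same file on HSIS; this one is what a THEC-fed tower (`twoSteps_unit_of_testSection`, successor) consumes.

WHY.  `inductiveStep`'s equivalence letter `(1 + ‖V″δ₀‖∕m)‖M‖ + m⁻¹ ≤ N` adds a dimensionless number to an inverse Hessian (the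
pricing desk's F634; idea-1's T-101: print's letters are dimensionless by weighted norms).  Scaling the action by `m⁻¹` costs
nothing — same critical points, same constrained critical branch, same slice — and turns the letter into
`(1 + ‖V″δ₀‖∕m)‖M‖ + 1 ≤ N`, the modulus into the relative one `c` (`‖V″x − V″δ₀‖ ≤ c·m`), the sizes into `M₃∕m, B∕m, G∕m`: THIS is
the form in which the tower's closing conditions are `t`-free (ASL §3) and in which a value audit can be stated once.  The file is
one theorem: HSIS's `inductiveStep` fed with ASL's `unit_letters`, conclusions written out for `m⁻¹ • V`; the two-line
dictionary back to `V ∘ σ` (criticality and the gradient letter are the same statements up to the factor `m`) is ASL §5.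

WHAT IS PROVED ([folklore] assembly; `E` a real Hilbert space (HSIS's requirement), `F` a real normed space):
* §1 **`inductiveStep_unit_critical`** — HSIC `inductiveStep_critical`'s hypotheses VERBATIM except: the equivalence letter is
  `(1 + ‖V″δ₀‖∕m)‖M‖ + 1 ≤ N`, the modulus letter is `‖V″x − V″δ₀‖ ≤ c·m` (`c : ℝ≥0` dimensionless, `c < N⁻¹`); conclusions =
  `inductiveStep`'s block (a)–(d) for the action `m⁻¹ • V` with Hessian `m⁻¹ • V″`, sizes `(M₃∕m, B∕m, G∕m)`, chart constant
  `K₁ = (N⁻¹ − c)⁻¹`, radius `(N⁻¹ − c)·r`, AND (o) the constrained criticality of `V` itself on the chart ball (from (o) for `m⁻¹ • V`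
  by `fderiv_const_smul_field` and `m⁻¹ ≠ 0`).
* (v2) THE DICTIONARY BACK TO `V ∘ σ` (`smul_comp`, `fderiv_smul_comp_eq_zero_iff`, `norm_fderiv_smul_comp`, `unit_comp_letters`) is
  `…ActionScalingLetters` §5 (v1.1), BY NAME — so (d) and (b) of §1 read on `V ∘ σ` directly; no copy here (X-HSUSC RETURN-1).

NOT HERE (honest): the two-step assembly ∕ the tower box in these units (HSTT ∕ HSTB re-read with `m = 1` at every scale and ASL §3's
`t`-free quantities — a successor junction once HSIS ∕ HSTT have oleans); the values of `N, c, K₁, γ, d` for print's action ((A3) ∕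
(A1c), NC-NE7b-α UNRULED); anything of Bałaban's.  BY-NAME EFFECT ON THE WALL: NONE.  NE7b NOT PRINTED ∕ NOT PROVED; spine PROVED
0∕9; rung (B)+1 on a FINITE torus — NOT infinite volume, NOT the mass gap, NOT Clay.  HONEST DEPENDENCY: continuum YM on T⁴ ⇐
BetaPertH ∧ nine spine estimates (0∕9 proved); BetaPertH ⇐ (D1) ∧ (D4) ∧ CAP+tail; G-an2-4 gates asym, D1 and NE2∕3∕4.
-/

set_option autoImplicit false

noncomputable section

namespace Summit.QuantumFields.BalabanUV.T4Continuum.NE7b.HardStepUnitStepCritical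

open Set Filter Topology Function Metric
open scoped NNReal
open Summit.QuantumFields.BalabanUV.T4Continuum.NE7b

variable {E F : Type*} [NormedAddCommGroup E] [InnerProductSpace ℝ E] [CompleteSpace E] [Nontrivial E]
  [NormedAddCommGroup F] [NormedSpace ℝ F]

/-! ## §1. The inductive step in coercivity units (the dictionary back to `V ∘ σ` — `smul_comp`,
`fderiv_smul_comp_eq_zero_iff`, `norm_fderiv_smul_comp`, `unit_comp_letters` — is `…ActionScalingLetters` §5, BY NAME; v2: the
former §2 copy is removed so that HSUS and HSUSC do not declare the same three lemmas twice, chair leaf-03 g150's X-HSUSC RETURN-1) -/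

/-- **ONE INDUCTIVE STEP OF THE HARD-STEP ROAD IN COERCIVITY UNITS.**  Scale-`k` letters of `V` as in HSIS `inductiveStep` — right
inverse `M` of `D`, kernel coercivity `m > 0` of `V″(δ₀)` on `ker D`, `V` twice differentiable on `closedBall δ₀ r` with Hessian `V″`,
Lipschitz letter `M₃`, sizes `B`, `G`, FULL criticality — but with the DIMENSIONLESS equivalence letter `(1 + ‖V″δ₀‖∕m)‖M‖ + 1 ≤ N`
and the RELATIVE modulus `‖V″x − V″δ₀‖ ≤ c·m`, `c < N⁻¹`.  Conclusion: `inductiveStep`'s block (a)–(d) for `m⁻¹ • V` (Hessian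
`m⁻¹ • V″`, sizes `M₃∕m, B∕m, G∕m`), chart constant `K₁ = (N⁻¹ − c)⁻¹` on `ball (Dδ₀) ((N⁻¹ − c)r)`. [folklore] -/
theorem inductiveStep_unit_critical (D : E →L[ℝ] F) (M : F →L[ℝ] E) (hM : ∀ w, D (M w) = w)
    {V : E → ℝ} {V'' : E → E →L[ℝ] E →L[ℝ] ℝ} {δ₀ : E} {m : ℝ} (hm : 0 < m)
    (hco : ∀ κ, D κ = 0 → m * ‖κ‖ ^ 2 ≤ V'' δ₀ κ κ)
    {N c : ℝ≥0} (hN : (1 + ‖V'' δ₀‖ / m) * ‖M‖ + 1 ≤ (N : ℝ)) (hc : c < N⁻¹) {r : ℝ} (hr : 0 < r)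
    (hVd : ∀ x ∈ closedBall δ₀ r, DifferentiableAt ℝ V x)
    (hV : ∀ x ∈ closedBall δ₀ r, HasFDerivAt (fderiv ℝ V) (V'' x) x)
    (hVc : ∀ x ∈ closedBall δ₀ r, ‖V'' x - V'' δ₀‖ ≤ c * m)
    (hcrit0 : fderiv ℝ V δ₀ = 0)
    {M₃ B G : ℝ} (hM₃ : 0 ≤ M₃)
    (hV''lip : ∀ x ∈ closedBall δ₀ r, ∀ x' ∈ closedBall δ₀ r, ‖V'' x - V'' x'‖ ≤ M₃ * ‖x - x'‖)
    (hVB : ∀ x ∈ closedBall δ₀ r, ‖V'' x‖ ≤ B) (hVG : ∀ x ∈ closedBall δ₀ r, ‖fderiv ℝ V x‖ ≤ G) :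
    ∃ σ : F → E, σ (D δ₀) = δ₀ ∧
      -- (o) CONSTRAINED CRITICALITY OF `V` ITSELF ALONG THE WHOLE CHART (THEC's hypothesis; `m⁻¹ • V` and `V` have the same
      --     constrained-critical points)
      (∀ w ∈ ball (D δ₀) (((N : ℝ)⁻¹ - c) * r), ∀ κ : E, D κ = 0 → fderiv ℝ V (σ w) κ = 0) ∧
      -- (a) the branch letters
      (∀ w ∈ ball (D δ₀) (((N : ℝ)⁻¹ - c) * r), σ w ∈ closedBall δ₀ r ∧ DifferentiableAt ℝ σ w ∧
        (∀ k, D (fderiv ℝ σ w k) = k) ∧ ‖fderiv ℝ σ w‖ ≤ ((N : ℝ)⁻¹ - c)⁻¹) ∧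
      (∀ w ∈ ball (D δ₀) (((N : ℝ)⁻¹ - c) * r), ∀ w' ∈ ball (D δ₀) (((N : ℝ)⁻¹ - c) * r),
        ‖σ w - σ w'‖ ≤ ((N : ℝ)⁻¹ - c)⁻¹ * ‖w - w'‖ ∧
        ‖fderiv ℝ σ w - fderiv ℝ σ w'‖ ≤ (((N : ℝ)⁻¹ - c)⁻¹) ^ 2 * (M₃ / m) * ((N : ℝ)⁻¹ - c)⁻¹ * ‖w - w'‖) ∧
      -- (b) the first-order letters of `(m⁻¹ • V) ∘ σ`
      (∀ w ∈ ball (D δ₀) (((N : ℝ)⁻¹ - c) * r), DifferentiableAt ℝ ((m⁻¹ • V) ∘ σ) w ∧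
        ‖fderiv ℝ ((m⁻¹ • V) ∘ σ) w‖ ≤ G / m * ((N : ℝ)⁻¹ - c)⁻¹) ∧
      (∀ w ∈ ball (D δ₀) (((N : ℝ)⁻¹ - c) * r), ∀ w' ∈ ball (D δ₀) (((N : ℝ)⁻¹ - c) * r),
        ‖fderiv ℝ ((m⁻¹ • V) ∘ σ) w - fderiv ℝ ((m⁻¹ • V) ∘ σ) w'‖ ≤
          (B / m * ((N : ℝ)⁻¹ - c)⁻¹ * ((N : ℝ)⁻¹ - c)⁻¹ +
            G / m * ((((N : ℝ)⁻¹ - c)⁻¹) ^ 2 * (M₃ / m) * ((N : ℝ)⁻¹ - c)⁻¹)) * ‖w - w'‖) ∧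
      -- (c) the Hessian letters of `(m⁻¹ • V) ∘ σ`
      (∀ w ∈ ball (D δ₀) (((N : ℝ)⁻¹ - c) * r),
        HasFDerivAt (fderiv ℝ ((m⁻¹ • V) ∘ σ)) ((m⁻¹ • V'' (σ w)).bilinearComp (fderiv ℝ σ w) (fderiv ℝ σ w)) w ∧
        ‖fderiv ℝ (fderiv ℝ ((m⁻¹ • V) ∘ σ)) w‖ ≤ B / m * (((N : ℝ)⁻¹ - c)⁻¹) ^ 2) ∧
      (∀ w ∈ ball (D δ₀) (((N : ℝ)⁻¹ - c) * r), ∀ w' ∈ ball (D δ₀) (((N : ℝ)⁻¹ - c) * r),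
        ‖fderiv ℝ (fderiv ℝ ((m⁻¹ • V) ∘ σ)) w - fderiv ℝ (fderiv ℝ ((m⁻¹ • V) ∘ σ)) w'‖ ≤
          M₃ / m * ((N : ℝ)⁻¹ - c)⁻¹ * (((N : ℝ)⁻¹ - c)⁻¹) ^ 2 * (1 + 2 * (B / m) * ((N : ℝ)⁻¹ - c)⁻¹) * ‖w - w'‖) ∧
      -- (d) FULL criticality at the next centre
      fderiv ℝ ((m⁻¹ • V) ∘ σ) (D δ₀) = 0 := by
  obtain ⟨h1, h2, h3, h4, h5, h6, h7, h8⟩ :=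
    ActionScalingLetters.unit_letters D hm hco hVd hV hVc hcrit0 hV''lip hVB hVG
  have hN' := ActionScalingLetters.unit_equivBound (Q := V'' δ₀) (nM := ‖M‖) hm hN
  have hM₃' : 0 ≤ M₃ / m := div_nonneg hM₃ hm.le
  obtain ⟨σ, hσ0, ho, ha, ha', hb, hb', hcc, hcc', hd⟩ :=
    HardStepInductiveStepCritical.inductiveStep_critical (V := m⁻¹ • V) (V'' := fun x => m⁻¹ • V'' x) (δ₀ := δ₀)
      D M hM one_pos h1 hN' hc hr h2 h3 h4 h5 hM₃' h6 h7 h8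
  refine ⟨σ, hσ0, ?_, ha, ha', hb, hb', hcc, hcc', hd⟩
  -- (o) for `V` from (o) for `m⁻¹ • V`: `fderiv (m⁻¹ • V) = m⁻¹ • fderiv V` and `m⁻¹ ≠ 0`
  intro w hw κ hκ
  have h := ho w hw κ hκ
  rw [fderiv_const_smul_field, Pi.smul_apply, smul_apply, smul_eq_mul, mul_eq_zero] at h
  exact h.resolve_left (inv_ne_zero hm.ne')

end Summit.QuantumFields.BalabanUV.T4Continuum.NE7b.HardStepUnitStepCritical

end
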